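import Summits.NavierStokesRegularity.NavierStokesRegularity.Theorems.OddMorawetzLocal.Negative.OddMorawetzLocalRefutationDefsIV
import Summits.NavierStokesRegularity.NavierStokesRegularity.Theorems.OddMorawetzOddMorawetzLocalActSemantics
import Summits.NavierStokesRegularity.NavierStokesRegularity.Theorems.OddMorawetzOddMorawetzLocalActFunctorial
import Summits.NavierStokesRegularity.NavierStokesRegularity.Theorems.OddMorawetzOddMorawetzLocalIdxComplete
import Summits.NavierStokesRegularity.NavierStokesRegularity.Theorems.OddMorawetzOddMorawetzLocalCoeffSemantics
import HarnessLib

/-!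
# Crux `OddMorawetzLocal` (stmt-NavierStokesRegularity-1376) — the action matrix represents composition with
`jetAct`, and is continuous in the group element

Support file for the refutation skeleton of `OddMorawetzLocal` (line `registered`, lead c1), registered stub
`actMatrix_semantics`.  Mathlib (`Finset` sums, `MvPolynomial.continuous_eval`) on top of the landed
`act_semantics` (`…ActSemantics`), `actMatrix_map` (`…ActFunctorial`), `idx_complete` parts
`canonical_of_mem_idx` / `mem_idx_of_canonical` / `nodup_idx` (`…IdxComplete`), `evalA_map_sortVars` /
`evalA_subst` (`…EvalA`) and `coeffOf_cons` (`…CoeffSemantics`); no named facts; nothing is defined.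

The refutation Haar-averages the coefficient vector `τ : V k` of a certificate density over `O(3)` with the
representation `g ↦ actMatrix k g`; the abstract averaging lemma needs this representation to be continuous and
to implement, on densities, the composition with the jet action `jetAct R` of the tree's rotation covariance.

* `densV_actMatrix_mulVec` — `densV k (actMatrix k g *ᵥ τ) = dens (act g (polyOfV k τ))`: both sides are
  expanded over the monomial basis `idx k`.  The value of `act g (polyOfV k τ)` is `Σ_j τ j · (value of
  act g [(1, m_j)])` (semantics `evalA_act`), and the value of `q := act g [(1, m_j)]` is regrouped as
  `Σ_i coeffOf q m_i · (value of m_i)` (`evalA_eq_sum_coeffOf`) because every monomial of `q` is a basis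
  monomial (`mem_idx_of_mem_act`: the action sends a canonical monomial to `sortVars`-sorted monomials with three
  `sortIdx`-sorted variables of the same orders — an invariant of `idxImages` / `actVar` / `prodList` — and
  `idx k` is complete) and `idx k` is duplicate-free.
* `continuous_actMatrix_mulVec` — by functoriality `actMatrix_map` applied to the evaluation of the GENERIC matrix
  of indeterminates, every entry of `actMatrix k g` is a polynomial in the entries of `g`.
* `densV_actMatrix_jetAct` — the first part combined with `act_semantics` on a symmetric jet.
-/

noncomputable section

set_option linter.dupNamespace false
set_option autoImplicit false

namespace Summit.NavierStokesRegularity.NavierStokesRegularity.Theorems.OddMorawetz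

/-! ### Evaluation of basis polynomials -/

/-- `evalA` of a cons with an explicit head pair. -/
private theorem evalA_cons_pair (c : ℝ) (m : List JVar) (p : JPoly ℝ) (ζ : JVar → ℝ) :
    JPoly.evalA ((c, m) :: p) ζ = c * (m.map ζ).prod + JPoly.evalA p ζ := by
  simp [JPoly.evalA]

/-- **The value of the polynomial of a coefficient vector**: `Σ_i τ i · Π m_i`. -/
theorem evalA_polyOfV (k : ℕ) (τ : V k) (ζ : JVar → ℝ) :
    JPoly.evalA (polyOfV k τ) ζ = ∑ i, τ i * (((idx k).get i).map ζ).prod := by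
  rw [Fin.sum_univ_def]
  simp only [JPoly.evalA, polyOfV, List.map_map, Function.comp_def]

/-- **The value of the action**: `evalA (act g p) ζ = evalA p (v ↦ evalA (actVar g v) ζ)`. -/
theorem evalA_act (g : Matrix (Fin 3) (Fin 3) ℝ) (p : JPoly ℝ) (ζ : JVar → ℝ) :
    JPoly.evalA (JPoly.act g p) ζ = JPoly.evalA p (fun v => JPoly.evalA (JPoly.actVar g v) ζ) := by
  simp only [JPoly.act]
  rw [evalA_map_sortVars, evalA_subst]

/-- **Regrouping by the basis.** A polynomial all of whose monomials are basis monomials of weight `k` evaluates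
to `Σ_i coeffOf q m_i · Π m_i` (the basis `idx k` is duplicate-free). -/
theorem evalA_eq_sum_coeffOf (k : ℕ) (ζ : JVar → ℝ) :
    ∀ q : JPoly ℝ, (∀ t ∈ q, t.2 ∈ idx k) →
      JPoly.evalA q ζ = ∑ i, JPoly.coeffOf q ((idx k).get i) * (((idx k).get i).map ζ).prod
  | [], _ => by simp [JPoly.evalA, JPoly.coeffOf]
  | (c, m) :: q, hq => by
    have hm : m ∈ idx k := hq (c, m) List.mem_cons_self
    obtain ⟨i₀, hi₀⟩ := List.get_of_mem hm
    have hinj : Function.Injective (idx k).get := List.nodup_iff_injective_get.1 (nodup_idx k)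
    rw [evalA_cons_pair, evalA_eq_sum_coeffOf k ζ q (fun t ht => hq t (List.mem_cons_of_mem _ ht))]
    simp only [coeffOf_cons, add_mul, Finset.sum_add_distrib]
    congr 1
    rw [Finset.sum_eq_single i₀]
    · rw [if_pos hi₀, hi₀]
    · intro i _ hi
      rw [if_neg (fun h => hi (hinj (h.trans hi₀.symm))), zero_mul]
    · intro h
      exact absurd (Finset.mem_univ i₀) h

/-! ### The action preserves the basis -/

/-- The target sequences listed by `idxImages g l` have the length of `l`. -/
private theorem length_of_mem_idxImages {R : Type} [Mul R] [One R] (g : Matrix (Fin 3) (Fin 3) R) :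
    ∀ (l : List (Fin 3)) (cj : R × List (Fin 3)), cj ∈ JPoly.idxImages g l → cj.2.length = l.length
  | [], cj, h => by
    simp only [JPoly.idxImages, List.mem_singleton] at h
    simp [h]
  | i :: is, cj, h => by
    simp only [JPoly.idxImages, List.mem_flatMap, List.mem_map, List.mem_finRange, true_and] at h
    obtain ⟨j, cj', hcj', rfl⟩ := h
    simp [length_of_mem_idxImages g is cj' hcj']

/-- Sorting preserves the length of an index list. -/
private theorem length_sortIdx' (l : List (Fin 3)) : (sortIdx l).length = l.length := by
  rw [sortIdx_eq_insertionSort, List.length_insertionSort]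

/-- `sortIdx` is idempotent. -/
private theorem sortIdx_sortIdx (l : List (Fin 3)) : sortIdx (sortIdx l) = sortIdx l :=
  (sortIdx_eq_self_iff _).2 (by rw [sortIdx_eq_insertionSort]; exact List.pairwise_insertionSort _ _)

/-- Every term of `actVar g v` is a single variable with a sorted index list of the order of `v`. -/
private theorem mem_actVar {R : Type} [Mul R] [One R] (g : Matrix (Fin 3) (Fin 3) R) (v : JVar)
    (t : R × List JVar) (ht : t ∈ JPoly.actVar g v) :
    ∃ w : JVar, t.2 = [w] ∧ sortIdx w.2 = w.2 ∧ w.2.length = v.2.length := by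
  simp only [JPoly.actVar, List.mem_flatMap, List.mem_map, List.mem_finRange, true_and] at ht
  obtain ⟨b, cj, hcj, rfl⟩ := ht
  exact ⟨(b, sortIdx cj.2), rfl, sortIdx_sortIdx _,
    by rw [length_sortIdx', length_of_mem_idxImages g v.2 cj hcj]⟩

/-- The invariant of `prodList (m.map (actVar g))`: every monomial has the variable orders of `m` (in order) and
sorted index lists. -/
private theorem prodList_actVar_inv {R : Type} [Mul R] [One R] (g : Matrix (Fin 3) (Fin 3) R) :
    ∀ (m : List JVar) (s : R × List JVar), s ∈ JPoly.prodList (m.map (JPoly.actVar g)) →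
      s.2.map (fun w => w.2.length) = m.map (fun v => v.2.length) ∧ ∀ w ∈ s.2, sortIdx w.2 = w.2
  | [], s, hs => by
    simp only [List.map_nil, JPoly.prodList, List.mem_singleton] at hs
    subst hs
    simp
  | v :: m, s, hs => by
    simp only [List.map_cons, JPoly.prodList, JPoly.mul, List.mem_flatMap, List.mem_map] at hs
    obtain ⟨a, ha, b, hb, rfl⟩ := hs
    obtain ⟨w, hw, hsort, hlen⟩ := mem_actVar g v a ha
    obtain ⟨ih₁, ih₂⟩ := prodList_actVar_inv g m b hb
    refine ⟨?_, ?_⟩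
    · show (a.2 ++ b.2).map (fun w => w.2.length) = _
      rw [hw, List.map_append, ih₁]
      simp [hlen]
    · show ∀ x ∈ a.2 ++ b.2, sortIdx x.2 = x.2
      rw [hw]
      intro x hx
      simp only [List.singleton_append, List.mem_cons] at hx
      rcases hx with rfl | hx
      · exact hsort
      · exact ih₂ x hx

/-- **The action preserves the basis**: every monomial of `act g [(c, m)]`, `m ∈ idx k`, is in `idx k`. -/
theorem mem_idx_of_mem_act {R : Type} [Mul R] [One R] (g : Matrix (Fin 3) (Fin 3) R) (c : R) {k : ℕ}
    {m : List JVar} (hm : m ∈ idx k) : ∀ t ∈ JPoly.act g [(c, m)], t.2 ∈ idx k := by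
  intro t ht
  obtain ⟨-, hlen, hcan, hw⟩ := canonical_of_mem_idx hm
  simp only [JPoly.act, JPoly.subst, List.flatMap_cons, List.flatMap_nil, List.append_nil, List.map_map,
    Function.comp_def, List.mem_map] at ht
  obtain ⟨s, hs, rfl⟩ := ht
  obtain ⟨hmap, hsorted⟩ := prodList_actVar_inv g m s hs
  show sortVars s.2 ∈ idx k
  have hp := perm_sortVars s.2
  refine mem_idx_of_canonical (sortVars_sortVars _) ?_ (fun v hv => ?_) ?_
  · rw [hp.length_eq, ← List.length_map (f := fun w : JVar => w.2.length), hmap, List.length_map, hlen]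
  · have hv' : v ∈ s.2 := hp.subset hv
    refine ⟨hsorted v hv', ?_⟩
    have hmem : v.2.length ∈ m.map (fun u : JVar => u.2.length) :=
      hmap ▸ List.mem_map.2 ⟨v, hv', rfl⟩
    obtain ⟨u, hu, heq⟩ := List.mem_map.1 hmem
    exact heq ▸ (hcan u hu).2
  · unfold monoWeight at hw ⊢
    rw [(hp.map _).sum_eq, hmap, hw]

/-! ### Part 1: the action matrix represents the action -/

/-- The value of the image of a basis monomial, regrouped by the basis: column `j` of `actMatrix k g`. -/
theorem evalA_act_basis (k : ℕ) (g : Matrix (Fin 3) (Fin 3) ℝ) (j : Fin (idx k).length) (ζ : JVar → ℝ) :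
    (((idx k).get j).map fun v => JPoly.evalA (JPoly.actVar g v) ζ).prod =
      ∑ i, actMatrix k g i j * (((idx k).get i).map ζ).prod := by
  have h₁ : JPoly.evalA [(1, (idx k).get j)] (fun v => JPoly.evalA (JPoly.actVar g v) ζ) =
      (((idx k).get j).map fun v => JPoly.evalA (JPoly.actVar g v) ζ).prod := by
    simp [JPoly.evalA]
  rw [← h₁, ← evalA_act, evalA_eq_sum_coeffOf k ζ _ (mem_idx_of_mem_act g (1 : ℝ) (List.get_mem (idx k) j))]
  rfl

/-- **Part 1.** `densV k (actMatrix k g *ᵥ τ) z = dens (act g (polyOfV k τ)) z` for every jet `z`. -/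
theorem densV_actMatrix_mulVec (k : ℕ) (g : Matrix (Fin 3) (Fin 3) ℝ) (τ : V k) (z : Jet3) :
    densV k ((actMatrix k g).mulVec τ) z = JPoly.dens (JPoly.act g (polyOfV k τ)) z := by
  simp only [densV, JPoly.dens]
  rw [evalA_polyOfV, evalA_act, evalA_polyOfV]
  simp only [Matrix.mulVec, dotProduct, evalA_act_basis, Finset.mul_sum, Finset.sum_mul]
  rw [Finset.sum_comm]
  exact Finset.sum_congr rfl fun j _ => Finset.sum_congr rfl fun i _ => by ring

/-! ### Part 2: continuity in the group element -/

/-- Every real matrix is the evaluation of the generic matrix of indeterminates, entrywise. -/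
private theorem matrix_eq_generic_map_eval (g : Matrix (Fin 3) (Fin 3) ℝ) :
    g = (Matrix.of fun a b : Fin 3 => (MvPolynomial.X (a, b) : MvPolynomial (Fin 3 × Fin 3) ℝ)).map
      (MvPolynomial.eval fun ab : Fin 3 × Fin 3 => g ab.1 ab.2) := by
  ext a b
  simp

/-- **The action matrix is a polynomial in the matrix entries**: it is the entrywise evaluation at `g` of the
action matrix of the generic matrix (functoriality `actMatrix_map`). -/
theorem actMatrix_eq_map_eval (k : ℕ) (g : Matrix (Fin 3) (Fin 3) ℝ) :
    actMatrix k g =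
      (actMatrix k (Matrix.of fun a b : Fin 3 => (MvPolynomial.X (a, b) : MvPolynomial (Fin 3 × Fin 3) ℝ))).map
        (MvPolynomial.eval fun ab : Fin 3 × Fin 3 => g ab.1 ab.2) := by
  rw [← actMatrix_map]
  exact congrArg (actMatrix k) (matrix_eq_generic_map_eval g)

/-- Every entry of `actMatrix k g` is continuous in `g`. -/
theorem continuous_actMatrix_entry (k : ℕ) (i j : Fin (idx k).length) :
    Continuous fun g : Matrix (Fin 3) (Fin 3) ℝ => actMatrix k g i j := by
  have h : (fun g : Matrix (Fin 3) (Fin 3) ℝ => actMatrix k g i j) = fun g =>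
      MvPolynomial.eval (fun ab : Fin 3 × Fin 3 => g ab.1 ab.2)
        (actMatrix k (Matrix.of fun a b : Fin 3 =>
          (MvPolynomial.X (a, b) : MvPolynomial (Fin 3 × Fin 3) ℝ)) i j) := by
    funext g
    rw [actMatrix_eq_map_eval k g, Matrix.map_apply]
  rw [h]
  exact (MvPolynomial.continuous_eval _).comp
    (continuous_pi fun ab : Fin 3 × Fin 3 => continuous_id.matrix_elem ab.1 ab.2)

/-- **Part 2.** `g ↦ (actMatrix k g *ᵥ τ) i` is continuous. -/
theorem continuous_actMatrix_mulVec (k : ℕ) (τ : V k) (i : Fin (idx k).length) :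
    Continuous fun g : Matrix (Fin 3) (Fin 3) ℝ => ((actMatrix k g).mulVec τ) i := by
  simp only [Matrix.mulVec, dotProduct]
  exact continuous_finsetSum _ fun j _ => (continuous_actMatrix_entry k i j).mul continuous_const

/-! ### Part 3: composition with `jetAct` on symmetric jets -/

/-- **Part 3.** On a symmetric jet, the action matrix of the matrix `g` of a linear isometry `R` implements the
composition of the density with `jetAct R`: `densV k (actMatrix k g *ᵥ τ) z = densV k τ (jetAct R z)`. -/
theorem densV_actMatrix_jetAct (k : ℕ) (g : Matrix (Fin 3) (Fin 3) ℝ)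
    (R : EuclideanSpace ℝ (Fin 3) ≃ₗᵢ[ℝ] EuclideanSpace ℝ (Fin 3))
    (hR : ∀ x, R x = WithLp.toLp 2 (g.mulVec (WithLp.ofLp x)))
    (hRs : ∀ x, R.symm x = WithLp.toLp 2 (g.transpose.mulVec (WithLp.ofLp x)))
    (τ : V k) (z : Jet3) (hz : z ∈ symmJets) :
    densV k ((actMatrix k g).mulVec τ) z = densV k τ (jetAct R z) := by
  have hz' : (∀ (w : Fin 2 → EuclideanSpace ℝ (Fin 3)) (σ : Equiv.Perm (Fin 2)), z.2.2.1 (w ∘ σ) = z.2.2.1 w) ∧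
      (∀ (w : Fin 3 → EuclideanSpace ℝ (Fin 3)) (σ : Equiv.Perm (Fin 3)), z.2.2.2 (w ∘ σ) = z.2.2.2 w) := hz
  rw [densV_actMatrix_mulVec]
  exact act_semantics g R hR hRs (polyOfV k τ) z hz'.1 hz'.2

/-! ### The registered stub -/

/-- **Stub `actMatrix_semantics`** (refutation of crux `OddMorawetzLocal`): (1) the action matrix `actMatrix k g`
on the coefficient space `V k` represents the substitution action `act g` on densities; (2) it is continuous in
`g`; (3) for the matrix `g` of a linear isometry `R` of `ℝ³` and a symmetric jet `z`, it implements composition of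
the density with `jetAct R`. -/
theorem actMatrix_semantics :
    (∀ (k : ℕ) (g : Matrix (Fin 3) (Fin 3) ℝ) (τ : V k) (z : Jet3),
      densV k ((actMatrix k g).mulVec τ) z = JPoly.dens (JPoly.act g (polyOfV k τ)) z) ∧
    (∀ (k : ℕ) (τ : V k) (i : Fin (idx k).length),
      Continuous fun g : Matrix (Fin 3) (Fin 3) ℝ => ((actMatrix k g).mulVec τ) i) ∧
    (∀ (k : ℕ) (g : Matrix (Fin 3) (Fin 3) ℝ) (R : EuclideanSpace ℝ (Fin 3) ≃ₗᵢ[ℝ] EuclideanSpace ℝ (Fin 3)),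
      (∀ x, R x = WithLp.toLp 2 (g.mulVec (WithLp.ofLp x))) →
      (∀ x, R.symm x = WithLp.toLp 2 (g.transpose.mulVec (WithLp.ofLp x))) →
      ∀ (τ : V k) (z : Jet3), z ∈ symmJets → densV k ((actMatrix k g).mulVec τ) z = densV k τ (jetAct R z)) :=
  ⟨densV_actMatrix_mulVec, continuous_actMatrix_mulVec,
    fun k g R hR hRs τ z hz => densV_actMatrix_jetAct k g R hR hRs τ z hz⟩

end Summit.NavierStokesRegularity.NavierStokesRegularity.Theorems.OddMorawetz

end
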